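import Summits.HubbardSuperconductivity.HubbardSuperconductivity.Theorems.SoloBlindOrderNotEnergyRobust
import Literature.MathematicalPhysics.QuantumLattice.FockRelabel
import Literature.MathematicalPhysics.QuantumLattice.HyperoctahedralFockAction
import HarnessLib

/-!
# The twisted competitors keep the crystal momentum when `L ∣ mN`

Part 4 of the obstruction lemma (`SoloBlindGaugeTwist`, `SoloBlindTwistAveraging`,
`SoloBlindOrderNotEnergyRobust`). Those files show that every normalised sector ground state `ψ` of
`hubbardTorus 2 L t U` has twisted copies `W_mᴴψ` (`W_m = twistOp m`, the Bloch / Lieb–Schultz–Mattis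
twist) in the SAME `(N, S^z)` sector, within an `L`-independent energy of the ground energy, with small
`d`-wave pair-field order. The one exact quantum number that could still separate `W_mᴴψ` from the ground
states is the crystal momentum. Here we compute it:

* `relabel_translate_twistOp` — `T_v W_m T_vᴴ = W_m · W_{const}` with the constant phase `χ(m v₁)⁻¹`
  (`T_v = fockTranslate v`, `χ = ZMod.toCircle`);
* `fockTranslate_mulVec_twist_conjTranspose_mulVec` — on `N`-particle states
  `T_v (W_mᴴ ψ) = χ(m v₁)^N • W_mᴴ (T_v ψ)`: the twist shifts the momentum `K₁` by `2π m N / L`;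
* `fockTranslate_mulVec_twist_conjTranspose_mulVec_of_mul_eq_zero` — if `N·m = 0` in `ℤ/L` (i.e. `L ∣ mN`)
  then `W_mᴴ` COMMUTES with every translation on the `N`-particle space, so it preserves every joint
  translation eigenspace (`twist_conjTranspose_mulVec_translate_eigenvector`);
* `exists_twist_low_energy_small_order_sameMomentum`, `dWave_order_not_momentum_robust` — the
  energy–order trade-off and the headline of part 3 with the extra conclusion that, when `L ∣ N`, the
  low-energy small-order competitor `φ` has the same translation eigenvalues as the ground state `ψ`
  (whenever `ψ` is a translation eigenvector);
* `summitFilling_zmod_eq_zero` — the divisibility `L ∣ N_L` holds along the sides `L = 16k` at the doping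
  `δ = 1/8` of the summit's filling rule `N_L = 2⌊(1-δ)L²/2⌋`, so the momentum-resolved loophole is closed on
  an infinite subsequence of sides for a summit-admissible `δ`.

Consequence: adding translation invariance / momentum resolution to an energy-robust hypothesis does not
rescue it (`SoloBlindOrderNotEnergyRobust`, docstring), at least along `L ∣ N`.

References: Lieb–Schultz–Mattis 1961; Watanabe, arXiv:1904.02700, §2.2.1 (momentum shift of the twist
operator, eq. for `T U_m T⁻¹`); Tada–Koma, arXiv:1605.06586. Elementary; [folklore].
-/

noncomputable section

namespace Summit.HubbardSuperconductivity.HubbardSuperconductivity.Theorems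

open Matrix Finset Literature.MathematicalPhysics.QuantumLattice
  Literature.MathematicalPhysics.QuantumFieldTheory
open Literature.Probability.LatticeModels (TorusSite)
open scoped ComplexConjugate

namespace GaugeTwist

/-! ### Relabelling phase gauges; constant phases on `N`-particle states -/

section PhaseGauge

variable {Λ Λ' : Type*} [LinearOrder Λ] [LinearOrder Λ'] [Fintype Λ] [Fintype Λ']

/-- `((a ^ n : Circle) : ℂ) = (a : ℂ) ^ n`. [folklore] -/
theorem circle_coe_pow (a : Circle) (n : ℕ) : ((a ^ n : Circle) : ℂ) = (a : ℂ) ^ n :=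
  map_pow Circle.coeHom a n

/-- **Relabelling a site-phase gauge transformation by a site bijection relabels the phase
function**: `Γ_f W_g Γ_fᴴ = W_{g ∘ f⁻¹}`. [folklore] -/
theorem relabel_mapEquiv_phaseGauge (f : Λ ≃ Λ') (g : Λ → Circle) :
    relabel (Orb.mapEquiv f) (phaseGauge g) = phaseGauge fun y => g (f.symm y) := by
  rw [phaseGauge_eq, phaseGauge_eq, relabel_diagonal]
  congr 1
  funext s'
  rw [Equiv.finsetCongr_symm, Equiv.finsetCongr_apply, Finset.prod_map]
  rfl

/-- **A constant phase acts on `N`-particle states as the scalar `a^N`.** [folklore] -/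
theorem phaseGauge_const_mulVec {N : ℕ} {ψ : Fock (Orb Λ)} (hψ : IsNParticle N ψ) (a : Circle) :
    phaseGauge (fun _ : Λ => a) *ᵥ ψ = ((a : ℂ) ^ N) • ψ := by
  funext s
  rw [phaseGauge_mulVec_apply, Finset.prod_const, Pi.smul_apply, smul_eq_mul]
  by_cases hs : s.card = N
  · rw [hs, circle_coe_pow]
  · rw [hψ s hs, mul_zero, mul_zero]

/-- `W_gᴴ` preserves the `N`-particle space. [folklore] -/
theorem IsNParticle.phaseGauge_conjTranspose_mulVec {N : ℕ} {ψ : Fock (Orb Λ)}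
    (hψ : IsNParticle N ψ) (g : Λ → Circle) : IsNParticle N ((phaseGauge g)ᴴ *ᵥ ψ) := by
  intro s hs
  rw [phaseGauge_conjTranspose, phaseGauge_mulVec_apply, hψ s hs, mul_zero]

end PhaseGauge

/-! ### Translating the twist -/

section Torus

variable {L : ℕ} [NeZero L]

/-- `toTorusSite` of the inverse of an induced site bijection. [folklore] -/
theorem toTorusSite_ofTorusEquiv_symm (g : TorusSite 2 L ≃ TorusSite 2 L) (u : FermionTorus 2 L) :
    ((FermionTorus.ofTorusEquiv g).symm u).toTorusSite = g.symm u.toTorusSite := by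
  apply g.injective
  rw [← FermionTorus.toTorusSite_ofTorusEquiv, Equiv.apply_symm_apply, Equiv.apply_symm_apply]

/-- **Translating the twist**: `T_v W_m T_vᴴ = W_m · W_{const χ(m v₁)⁻¹}` — the character
`x ↦ χ(m x₁)` translated by `-v` is itself times the constant `χ(m v₁)⁻¹`.
Watanabe (2019) §2.2.1. [folklore] -/
theorem relabel_translate_twistOp (v : TorusSite 2 L) (m : ZMod L) :
    relabel (Orb.translate v) (twistOp m) =
      twistOp m * phaseGauge (fun _ : FermionTorus 2 L => (ZMod.toCircle (m * v 0))⁻¹) := by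
  rw [twistOp, Orb.translate, relabel_mapEquiv_phaseGauge, phaseGauge_mul]
  congr 1
  funext u
  simp only [Pi.mul_apply, toTorusSite_ofTorusEquiv_symm, Equiv.addRight_symm, Equiv.coe_addRight,
    twistChar, Pi.add_apply, Pi.neg_apply, mul_add, mul_neg, AddChar.map_add_eq_mul,
    AddChar.map_neg_eq_inv]

/-- **The twist shifts the crystal momentum by `2πmN/L`**: for an `N`-particle state `ψ`,
`T_v (W_mᴴ ψ) = χ(m v₁)^N • W_mᴴ (T_v ψ)`. Watanabe (2019) §2.2.1; Tada–Koma (2016). [folklore] -/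
theorem fockTranslate_mulVec_twist_conjTranspose_mulVec (v : TorusSite 2 L) (m : ZMod L) {N : ℕ}
    {ψ : Fock (Orb (FermionTorus 2 L))} (hψ : IsNParticle N ψ) :
    (fockTranslate v).val *ᵥ ((twistOp m)ᴴ *ᵥ ψ) =
      ((ZMod.toCircle (m * v 0) : ℂ) ^ N) • ((twistOp m)ᴴ *ᵥ ((fockTranslate v).val *ᵥ ψ)) := by
  set c : Circle := ZMod.toCircle (m * v 0) with hc
  -- `T W_mᴴ Tᴴ = (T W_m Tᴴ)ᴴ = (W_m G)ᴴ = Gᴴ W_mᴴ`, `G` the constant phase `c⁻¹`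
  have hconj : (fockTranslate v).val * (twistOp m)ᴴ * (fockTranslate v).valᴴ =
      phaseGauge (fun _ : FermionTorus 2 L => c) * (twistOp m)ᴴ := by
    have h1 : (fockTranslate v).val * (twistOp m)ᴴ * (fockTranslate v).valᴴ =
        (relabel (Orb.translate v) (twistOp m))ᴴ := by
      rw [relabel_eq_fockRelabel_conj, conjTranspose_mul, conjTranspose_mul,
        conjTranspose_conjTranspose, Matrix.mul_assoc]
    rw [h1, relabel_translate_twistOp, conjTranspose_mul, phaseGauge_conjTranspose]
    congr 2
    funext u
    rw [Pi.inv_apply, inv_inv]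
  have hmul := fockRelabel_mul_eq_of_conj_eq (Orb.translate v) hconj
  have hTψ : IsNParticle N ((fockTranslate v).val *ᵥ ψ) := hψ.fockRelabel_mulVec _
  have hX : IsNParticle N ((twistOp m)ᴴ *ᵥ ((fockTranslate v).val *ᵥ ψ)) :=
    IsNParticle.phaseGauge_conjTranspose_mulVec hTψ _
  rw [mulVec_mulVec, show (fockTranslate v).val = (fockRelabel (Orb.translate v)).val from rfl, hmul,
    ← mulVec_mulVec, ← mulVec_mulVec, phaseGauge_const_mulVec hX c]

/-- **When `L ∣ mN` the twist commutes with all translations on the `N`-particle space**: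
`N·m = 0` in `ℤ/L` ⟹ `T_v (W_mᴴ ψ) = W_mᴴ (T_v ψ)`. [folklore] -/
theorem fockTranslate_mulVec_twist_conjTranspose_mulVec_of_mul_eq_zero (v : TorusSite 2 L)
    (m : ZMod L) {N : ℕ} {ψ : Fock (Orb (FermionTorus 2 L))} (hψ : IsNParticle N ψ)
    (hNm : (N : ZMod L) * m = 0) :
    (fockTranslate v).val *ᵥ ((twistOp m)ᴴ *ᵥ ψ) =
      (twistOp m)ᴴ *ᵥ ((fockTranslate v).val *ᵥ ψ) := by
  have h1 : (ZMod.toCircle (m * v 0)) ^ N = 1 := by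
    rw [← AddChar.map_nsmul_eq_pow, nsmul_eq_mul, ← mul_assoc, hNm, zero_mul,
      AddChar.map_zero_eq_one]
  rw [fockTranslate_mulVec_twist_conjTranspose_mulVec v m hψ, ← circle_coe_pow, h1, Circle.coe_one,
    one_smul]

/-- **Twisting preserves translation eigenvectors when `L ∣ mN`**: if `T_v ψ = μ ψ` for an
`N`-particle `ψ` and `N·m = 0` in `ℤ/L`, then `T_v (W_mᴴψ) = μ (W_mᴴψ)`. [folklore] -/
theorem twist_conjTranspose_mulVec_translate_eigenvector (v : TorusSite 2 L) (m : ZMod L) {N : ℕ}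
    {ψ : Fock (Orb (FermionTorus 2 L))} (hψ : IsNParticle N ψ) (hNm : (N : ZMod L) * m = 0) {μ : ℂ}
    (hv : (fockTranslate v).val *ᵥ ψ = μ • ψ) :
    (fockTranslate v).val *ᵥ ((twistOp m)ᴴ *ᵥ ψ) = μ • ((twistOp m)ᴴ *ᵥ ψ) := by
  rw [fockTranslate_mulVec_twist_conjTranspose_mulVec_of_mul_eq_zero v m hψ hNm, hv, mulVec_smul]

/-! ### The energy–order trade-off with momentum conservation -/

/-- **Energy–order trade-off, momentum-resolved** (`L ≥ 3`, `|g| ≤ 1`, `1 ≤ M < L`, `L ∣ N`). As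
`exists_twist_low_energy_small_order`, with the extra conclusion that the competitor `φ` (a twisted
copy `W_mᴴψ`, `1 ≤ m ≤ M`) has the same eigenvalue as `ψ` under every translation of which `ψ` is an
eigenvector. [folklore] -/
theorem exists_twist_low_energy_small_order_sameMomentum (hL : 3 ≤ L) (t U : ℝ) {N : ℕ} {Mz : ℝ}
    {ψ : Fock (Orb (FermionTorus 2 L))} (hψ : IsGroundStateInSector (hubbardTorus 2 L t U) N Mz ψ)
    (h1 : star ψ ⬝ᵥ ψ = 1) (hN : (N : ZMod L) = 0) (g : (Fin 2 → ℤ) → ℝ) (hg : ∀ e, |g e| ≤ 1)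
    {M : ℕ} (hM : 1 ≤ M) (hML : M < L) :
    ∃ φ ∈ szSector N Mz, star φ ⬝ᵥ φ = 1 ∧
      (star φ ⬝ᵥ (hubbardTorus 2 L t U *ᵥ φ)).re ≤
          (hubbardTorus 2 L t U).minEnergyOn (szSector N Mz) +
            8 * Real.pi ^ 2 * |t| * ((M : ℝ) ^ 2 + M) ∧
      (expect ((pairField g L)ᴴ * pairField g L) φ).re ≤ 400 * (L : ℝ) ^ 4 / M ∧
      ∀ (v : TorusSite 2 L) (μ : ℂ), (fockTranslate v).val *ᵥ ψ = μ • ψ →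
        (fockTranslate v).val *ᵥ φ = μ • φ := by
  classical
  set T : ZMod L → ℝ := fun m => (star (pairField g L *ᵥ ((twistOp m)ᴴ *ᵥ ψ)) ⬝ᵥ
    (pairField g L *ᵥ ((twistOp m)ᴴ *ᵥ ψ))).re with hT
  have hT0 : ∀ m, 0 ≤ T m := fun m => by
    simp only [hT]
    rw [← norm_toLp_sq_eq_re]
    positivity
  have htot : ∑ m : ZMod L, T m ≤ 400 * (L : ℝ) ^ 4 := by
    have := sum_twist_pairField_order_le g hg ψ
    rwa [h1, Complex.one_re, mul_one] at this
  set S : Finset ℕ := Finset.Icc 1 M with hS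
  have hinj : ∀ i ∈ S, ∀ j ∈ S, ((i : ℕ) : ZMod L) = ((j : ℕ) : ZMod L) → i = j := by
    intro i hi j hj hij
    rw [hS, Finset.mem_Icc] at hi hj
    have := (ZMod.natCast_eq_natCast_iff' i j L).1 hij
    rwa [Nat.mod_eq_of_lt (by omega), Nat.mod_eq_of_lt (by omega)] at this
  have hpart : ∑ j ∈ S, T (j : ZMod L) ≤ 400 * (L : ℝ) ^ 4 := by
    rw [← Finset.sum_image hinj]
    exact (Finset.sum_le_sum_of_subset_of_nonneg (Finset.subset_univ _) fun m _ _ => hT0 m).trans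
      htot
  have hSne : S.Nonempty := ⟨1, by rw [hS, Finset.mem_Icc]; omega⟩
  have hM0 : (M : ℝ) ≠ 0 := by exact_mod_cast (show M ≠ 0 by omega)
  obtain ⟨j, hjS, hj⟩ : ∃ j ∈ S, T (j : ZMod L) ≤ 400 * (L : ℝ) ^ 4 / M := by
    apply Finset.exists_le_of_sum_le hSne
    rw [Finset.sum_const, hS, Nat.card_Icc, Nat.add_sub_cancel, nsmul_eq_mul, ← mul_div_assoc,
      mul_div_cancel_left₀ _ hM0]
    exact hpart
  rw [hS, Finset.mem_Icc] at hjS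
  have hψN : IsNParticle N ψ := ((mem_szSector_iff N Mz ψ).1 hψ.1).1
  refine ⟨(twistOp (j : ZMod L))ᴴ *ᵥ ψ, twist_mem_szSector _ hψ.1,
    by rw [star_twist_dotProduct_twist, h1], ?_, ?_, fun v μ hv => ?_⟩
  · refine (re_twist_energy_le_minEnergyOn_add hL t U hψ h1 j (Or.inl rfl)).trans ?_
    have hjM : (j : ℝ) ≤ M := by exact_mod_cast hjS.2
    have hj0 : (0 : ℝ) ≤ j := Nat.cast_nonneg j
    have hsq : (j : ℝ) ^ 2 + j ≤ (M : ℝ) ^ 2 + M := by nlinarith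
    have := mul_le_mul_of_nonneg_left hsq (by positivity : (0 : ℝ) ≤ 8 * Real.pi ^ 2 * |t|)
    linarith
  · rw [PosSemidefTrace.expect_conjTranspose_mul]
    exact hj
  · exact twist_conjTranspose_mulVec_translate_eigenvector v _ hψN (by rw [hN, zero_mul]) hv

/-- **The ground-state d-wave order criterion is not robust even with momentum resolution.** As
`dWave_order_not_energy_robust`: for all `t U` and every `c > 0` there are an `L`-independent `ε`
(`8π²|t|(M²+M)`, `M = ⌊400/c⌋+1`) and `L₀ = M+3` such that on every torus of side `L = n+1 ≥ L₀` with
`L ∣ N`, for every normalised ground state `ψ` of the joint sector `(N, S^z)`, some normalised `φ` of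
the same sector, with the same eigenvalue as `ψ` under every lattice translation of which `ψ` is an
eigenvector, lies within `ε` of the sector ground energy and has `re ⟨φ, Δ_d†Δ_d φ⟩ < c L⁴`. So a
translation-invariant / fixed-crystal-momentum version of an energy-robust hypothesis does not imply
the summit's every-ground-state `L⁴` bound either (along `L ∣ N`). [folklore] -/
theorem dWave_order_not_momentum_robust (t U c : ℝ) (hc : 0 < c) :
    ∃ ε : ℝ, ∃ L₀ : ℕ, ∀ n : ℕ, L₀ ≤ n + 1 →
      ∀ {N : ℕ} {Mz : ℝ} {ψ : Fock (Orb (FermionTorus 2 (n + 1)))},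
        (N : ZMod (n + 1)) = 0 →
        IsGroundStateInSector (hubbardTorus 2 (n + 1) t U) N Mz ψ → star ψ ⬝ᵥ ψ = 1 →
        ∃ φ ∈ szSector N Mz, star φ ⬝ᵥ φ = 1 ∧
          (star φ ⬝ᵥ (hubbardTorus 2 (n + 1) t U *ᵥ φ)).re ≤
              (hubbardTorus 2 (n + 1) t U).minEnergyOn (szSector N Mz) + ε ∧
          (expect ((pairField dWaveFormFactor (n + 1))ᴴ * pairField dWaveFormFactor (n + 1)) φ).re <
            c * ((n : ℝ) + 1) ^ 4 ∧
          ∀ (v : TorusSite 2 (n + 1)) (μ : ℂ), (fockTranslate v).val *ᵥ ψ = μ • ψ →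
            (fockTranslate v).val *ᵥ φ = μ • φ := by
  set M : ℕ := ⌊400 / c⌋₊ + 1 with hM
  refine ⟨8 * Real.pi ^ 2 * |t| * ((M : ℝ) ^ 2 + M), M + 3, fun n hn N Mz ψ hN hψ h1 => ?_⟩
  have hM1 : 1 ≤ M := by omega
  have hML : M < n + 1 := by omega
  obtain ⟨φ, hφ, hφ1, hE, hO, hmom⟩ := exists_twist_low_energy_small_order_sameMomentum (L := n + 1)
    (by omega) t U hψ h1 hN dWaveFormFactor abs_dWaveFormFactor_le_one hM1 hML
  refine ⟨φ, hφ, hφ1, hE, hO.trans_lt ?_, hmom⟩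
  have hcM : 400 / c < M := by rw [hM]; push_cast; exact Nat.lt_floor_add_one _
  have hn4 : (0 : ℝ) < ((n : ℝ) + 1) ^ 4 := by positivity
  have hM0 : (0 : ℝ) < M := by exact_mod_cast hM1
  rw [div_lt_iff₀ hM0]
  rw [div_lt_iff₀ hc] at hcM
  push_cast
  nlinarith [mul_lt_mul_of_pos_right hcM hn4]

end Torus

/-! ### The divisibility `L ∣ N_L` along a summit-admissible filling -/

/-- **`L ∣ N_L` infinitely often for a summit-admissible doping**: with `δ = 1/8` and sides `L = 16k`,
the summit's filling rule `N_L = 2⌊(1-δ)L²/2⌋ = 224k²` is a multiple of `L`. [folklore] -/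
theorem summitFilling_zmod_eq_zero (k : ℕ) :
    ((2 * ⌊(1 - (1 / 8 : ℝ)) * ((16 * k : ℕ) : ℝ) ^ 2 / 2⌋₊ : ℕ) : ZMod (16 * k)) = 0 := by
  have hfl : ⌊(1 - (1 / 8 : ℝ)) * ((16 * k : ℕ) : ℝ) ^ 2 / 2⌋₊ = 112 * k ^ 2 := by
    have : (1 - (1 / 8 : ℝ)) * ((16 * k : ℕ) : ℝ) ^ 2 / 2 = ((112 * k ^ 2 : ℕ) : ℝ) := by
      push_cast; ring
    rw [this, Nat.floor_natCast]
  rw [hfl, show 2 * (112 * k ^ 2) = 16 * k * (14 * k) by ring, Nat.cast_mul, ZMod.natCast_self,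
    zero_mul]

end GaugeTwist

end Summit.HubbardSuperconductivity.HubbardSuperconductivity.Theorems
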